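import Summits.AtomisticToContinuum.Crystallization.Theses.PalmUnimodularRigidity
import Summits.AtomisticToContinuum.Crystallization.Theorems.MinimiserShells.Negative.LoadBearing
import Summits.AtomisticToContinuum.Crystallization.Theorems.MinimiserShells.Negative.Rootedness
import Summits.AtomisticToContinuum.Crystallization.Theorems.LayeredLawsSelectHcp.Negative.Threshold
import Summits.AtomisticToContinuum.Crystallization.Theorems.ChargedEnergyGap.Negative.Unconditional
import Summits.AtomisticToContinuum.Crystallization.Theorems.PalmUnimodularRigidityMinimiserShellsMuGSCBasics
import Literature.Probability.Process.PointStationaryLaw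
import Literature.MathematicalPhysics.StatisticalMechanics.RootEnergy
import Literature.MathematicalPhysics.StatisticalMechanics.MuGSC

/-!
# Volume growth of `e*`-μGSCs of Lennard-Jones from a particle-level surface tension

Groundwork (`--supports stmt-AtomisticToContinuum-9225`, registered marker `stub_dlrBadZeroDensity_part02`) for the open
stub S3′ of line `equilibrium-in-law-surgery` (crux `MinimiserShells`): the gen-2 stub S4 `stub_dlrVolumeGrowth` (ONE `c > 0`
with `c R³ ≤ #(S ∩ B̄_R(x))` for every uniformly discrete Sütő `μ`GSC `S` of Lennard-Jones at `μ = e*`, `x ∈ S`, `R ≥ 1`)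
REDUCED to the single open input (ST) `∃ σ > 0, GapWith (1/100) 0 (-σ)`, i.e. `E_LJ(y) ≥ N·e* + σ·N^{2/3}` for all finite
injective `y` (particle-level positive surface tension; `GapWith` of `ChargedEnergyGap/Negative/FarCopies.lean` with price
`κ = 0` and negative boundary allowance; the 3-D analogue of the `N^{1/2}`-law of Heitmann–Radin / Au Yeung–Friesecke–Schmidt,
open): `dlrVolumeGrowth_of_gapWith`, with `c = min(1, σ/(12 K₀))³/8`, `K₀ = 29·6750·731/12`.  Proof: (1) uniform hard core
`1/3` (`Basics.le_dist`); (2) per integer radius `j`, the removal test of `F_j = S ∩ B̄_j(x)` against (ST) gives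
`σ n_j^{2/3} ≤ −I(F_j, S ∖ F_j)`, and an atom at depth `k = ⌊j − |y−x|⌋` feels the outside by at most `A₀ max(k,1/3)⁻³`
(two-scale shell sum `Basics.summable_inv_pow_six`, `|V_LJ(s)| ≤ (731/12)s⁻⁶` for `s ≥ 1/3`); (3) summing over `i ≤ j` and
swapping sums (each atom met at pairwise distinct depths, total weight `≤ K₀`): `σ ∑_{i≤j} n_i^{2/3} ≤ K₀ n_j`; (4) strong
induction (`∑_{i<j} i² ≥ j³/12`) gives `n_j ≥ c₀ j³`, and `#(S ∩ B̄_R(x)) ≥ n_{⌊R⌋}`, `⌊R⌋ ≥ R/2`.  No `def`s.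
Authored by the lead's S4 stub worker (wave 1), landed by the lead.
-/

noncomputable section

open MeasureTheory
open scoped ENNReal BigOperators

namespace Summit.AtomisticToContinuum.Crystallization.Theorems.PalmUnimodularRigidityMinimiserShells.VolumeGrowth

open Literature.Probability.Process (IsPointStationaryLaw IsRootedHardCore count_restrict_singleton_ne_zero_iff
  map_sub_count_restrict)
open Literature.MathematicalPhysics.StatisticalMechanics (lennardJones IsMuGSC UniformlyDiscrete)
open Summit.AtomisticToContinuum.Crystallization.Theses.PalmUnimodularRigidity (MinimiserShells UnimodularEnergyLowerBound)
open Summit.AtomisticToContinuum.Crystallization.Theorems.MinimiserShells.Negative.LoadBearing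
  (eStar meanRootEnergy GoodShell minimiserShells_iff)
open Literature.MathematicalPhysics.StatisticalMechanics (interactionEnergy fieldEnergy fieldEnergy_eq)
open Summit.AtomisticToContinuum.Crystallization.Theorems.ChargedEnergyGapNegative (GapWith)
open Summit.AtomisticToContinuum.Crystallization.Theorems.PalmUnimodularRigidityMinimiserShells.VolumeGrowth.Basics
  (summable_inv_pow_six le_dist)
open Summit.AtomisticToContinuum.Crystallization.Theorems.MinimiserShells.Negative.Rootedness (E3)

/-! ## The open input (ST), unfolded -/

/-- `GapWith η 0 (-σ)` says `N·e* + σ·N^{2/3} ≤ E_LJ(y)` for every finite injective `y`. -/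
theorem surface_of_gapWith {η σ : ℝ} (h : GapWith η 0 (-σ)) (N : ℕ)
    (y : Fin N → EuclideanSpace ℝ (Fin 3)) (hy : Function.Injective y) :
    (N : ℝ) * eStar + σ * (N : ℝ) ^ (2 / 3 : ℝ) ≤ interactionEnergy lennardJones y := by
  have := h N y hy
  simp only [zero_mul, add_zero, neg_mul, sub_neg_eq_add] at this
  exact this

/-! ## The depth kernel `κ_k = A₀·max(k,1/3)⁻³`, `A₀ = 6750·731/12`, total mass `≤ K₀ = 29 A₀` (constants written out) -/

/-- `|V_LJ(s)| ≤ (731/12)·s⁻⁶` for `s ≥ 1/3` (`s⁻¹² ≤ 3⁶ s⁻⁶`, `3⁶/12 + 1/6 = 731/12`). -/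
theorem abs_lennardJones_le_of_third_le {s : ℝ} (hs : 1 / 3 ≤ s) :
    |lennardJones s| ≤ 731 / 12 * s⁻¹ ^ 6 := by
  have h0 : 0 < s := by linarith
  have hinv : s⁻¹ ≤ 3 := (inv_anti₀ (by norm_num : (0 : ℝ) < 1 / 3) hs).trans_eq (by norm_num)
  have hi0 : 0 ≤ s⁻¹ := inv_nonneg.2 h0.le
  have h6 : s⁻¹ ^ 6 ≤ 3 ^ 6 := pow_le_pow_left₀ hi0 hinv 6
  have h12 : s⁻¹ ^ 12 = s⁻¹ ^ 6 * s⁻¹ ^ 6 := by ring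
  have hA : 0 ≤ s⁻¹ ^ 6 := pow_nonneg hi0 6
  rw [abs_le]
  unfold lennardJones
  rw [h12]
  constructor <;> nlinarith [mul_le_mul_of_nonneg_right h6 hA]

/-- `0 ≤ κ_k`. -/
theorem kernel_nonneg (k : ℕ) : 0 ≤ ((6750 : ℝ) * (731 / 12)) * (max (k : ℝ) (1 / 3))⁻¹ ^ 3 := by positivity

/-- `κ_k ≤ ((6750 : ℝ) * (731 / 12)) k⁻²` for `k ≥ 1`. -/
theorem kernel_le_of_pos {k : ℕ} (hk : 1 ≤ k) :
    ((6750 : ℝ) * (731 / 12)) * (max (k : ℝ) (1 / 3))⁻¹ ^ 3 ≤ ((6750 : ℝ) * (731 / 12)) * ((k : ℝ) ^ 2)⁻¹ := by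
  have hk1 : (1 : ℝ) ≤ k := by exact_mod_cast hk
  have hmax : max (k : ℝ) (1 / 3) = k := max_eq_left (by linarith)
  rw [hmax, inv_pow]
  exact mul_le_mul_of_nonneg_left (inv_anti₀ (by positivity) (pow_le_pow_right₀ hk1 (by norm_num)))
    (by positivity)

/-- Any sum of kernel values over DISTINCT depths is at most `((6750 : ℝ) * (731 / 12) * 29)`. -/
theorem sum_kernel_le (T : Finset ℕ) : ∑ k ∈ T, ((6750 : ℝ) * (731 / 12)) * (max (k : ℝ) (1 / 3))⁻¹ ^ 3 ≤ ((6750 : ℝ) * (731 / 12) * 29) := by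
  classical
  have h0 : ∑ k ∈ T.filter (fun k => k = 0), ((6750 : ℝ) * (731 / 12)) * (max (k : ℝ) (1 / 3))⁻¹ ^ 3 ≤ ((6750 : ℝ) * (731 / 12)) * 27 := by
    rw [Finset.filter_eq']
    split_ifs
    · rw [Finset.sum_singleton]; norm_num
    · rw [Finset.sum_empty]; positivity
  have h1 : ∑ k ∈ T.filter (fun k => ¬ k = 0), ((6750 : ℝ) * (731 / 12)) * (max (k : ℝ) (1 / 3))⁻¹ ^ 3 ≤ ((6750 : ℝ) * (731 / 12)) * 2 := by
    set M := T.sup id + 1 with hM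
    have hsub : T.filter (fun k => ¬ k = 0) ⊆ Finset.Ioo 0 M := fun k hk => by
      rw [Finset.mem_filter] at hk
      rw [Finset.mem_Ioo]
      exact ⟨Nat.pos_of_ne_zero hk.2, Nat.lt_succ_of_le (Finset.le_sup (f := id) hk.1)⟩
    calc ∑ k ∈ T.filter (fun k => ¬ k = 0), ((6750 : ℝ) * (731 / 12)) * (max (k : ℝ) (1 / 3))⁻¹ ^ 3
        ≤ ∑ k ∈ Finset.Ioo 0 M, ((6750 : ℝ) * (731 / 12)) * (max (k : ℝ) (1 / 3))⁻¹ ^ 3 :=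
          Finset.sum_le_sum_of_subset_of_nonneg hsub fun k _ _ => kernel_nonneg k
      _ ≤ ∑ k ∈ Finset.Ioo 0 M, ((6750 : ℝ) * (731 / 12)) * ((k : ℝ) ^ 2)⁻¹ :=
          Finset.sum_le_sum fun k hk => kernel_le_of_pos (Finset.mem_Ioo.1 hk).1
      _ = ((6750 : ℝ) * (731 / 12)) * ∑ k ∈ Finset.Ioo 0 M, ((k : ℝ) ^ 2)⁻¹ := by rw [Finset.mul_sum]
      _ ≤ ((6750 : ℝ) * (731 / 12)) * 2 := by
          refine mul_le_mul_of_nonneg_left ?_ (by positivity)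
          simpa using sum_Ioo_inv_sq_le (α := ℝ) 0 M
  rw [← Finset.sum_filter_add_sum_filter_not T (fun k => k = 0)]
  linarith

/-- For radii `i ≥ d`, the depths `⌊i − d⌋` are pairwise distinct, so `∑_i κ_{⌊i−d⌋} ≤ ((6750 : ℝ) * (731 / 12) * 29)`. -/
theorem sum_kernel_floor_le (d : ℝ) (j : ℕ) [DecidablePred fun i : ℕ => d ≤ (i : ℝ)] :
    ∑ i ∈ (Finset.range (j + 1)).filter (fun i : ℕ => d ≤ (i : ℝ)),
      ((6750 : ℝ) * (731 / 12)) * (max ((⌊(i : ℝ) - d⌋₊ : ℕ) : ℝ) (1 / 3))⁻¹ ^ 3 ≤ ((6750 : ℝ) * (731 / 12) * 29) := by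
  classical
  set I := (Finset.range (j + 1)).filter (fun i : ℕ => d ≤ (i : ℝ)) with hI
  have hinj : ∀ i ∈ I, ∀ i' ∈ I, ⌊(i : ℝ) - d⌋₊ = ⌊(i' : ℝ) - d⌋₊ → i = i' := by
    intro i hi i' hi' h
    have hdi : d ≤ (i : ℝ) := (Finset.mem_filter.1 hi).2
    have hdi' : d ≤ (i' : ℝ) := (Finset.mem_filter.1 hi').2
    have h1 := Nat.floor_le (sub_nonneg.2 hdi)
    have h2 := Nat.lt_floor_add_one ((i : ℝ) - d)
    have h3 := Nat.floor_le (sub_nonneg.2 hdi')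
    have h4 := Nat.lt_floor_add_one ((i' : ℝ) - d)
    have hcast : ((⌊(i : ℝ) - d⌋₊ : ℕ) : ℝ) = ((⌊(i' : ℝ) - d⌋₊ : ℕ) : ℝ) := by exact_mod_cast h
    have b1 : i < i' + 1 := by exact_mod_cast (by linarith : (i : ℝ) < (i' : ℝ) + 1)
    have b2 : i' < i + 1 := by exact_mod_cast (by linarith : (i' : ℝ) < (i : ℝ) + 1)
    omega
  rw [← Finset.sum_image (g := fun i : ℕ => ⌊(i : ℝ) - d⌋₊)
    (f := fun k : ℕ => ((6750 : ℝ) * (731 / 12)) * (max (k : ℝ) (1 / 3))⁻¹ ^ 3) hinj]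
  exact sum_kernel_le _

/-! ## Field bounds: an atom at distance `≥ ρ` from a `1/3`-separated set -/

/-- `∑_{z ∈ Z} |V_LJ(|y − z|)| ≤ ((6750 : ℝ) * (731 / 12)) ρ⁻³` if `Z` is `1/3`-separated and at distance `≥ ρ ≥ 1/3` from `y`
(two-scale shell sum). -/
theorem tsum_abs_lennardJones_le {Z : Set E3} (hZ : ∀ z ∈ Z, ∀ w ∈ Z, z ≠ w → 1 / 3 ≤ dist z w)
    {y : E3} {ρ : ℝ} (hρ : 1 / 3 ≤ ρ) (hy : ∀ z ∈ Z, ρ ≤ dist y z) :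
    Summable (fun z : Z => |lennardJones (dist y z)|) ∧
      ∑' z : Z, |lennardJones (dist y z)| ≤ ((6750 : ℝ) * (731 / 12)) * ρ⁻¹ ^ 3 := by
  obtain ⟨hs6, ht6⟩ :=
    summable_inv_pow_six (X := Z) (p := y) (by norm_num : (0 : ℝ) < 1 / 3) hρ hy hZ
  have hpt : ∀ z : Z, |lennardJones (dist y (z : E3))| ≤ 731 / 12 * (dist y (z : E3))⁻¹ ^ 6 :=
    fun z => abs_lennardJones_le_of_third_le (hρ.trans (hy z z.2))
  have hsum : Summable fun z : Z => |lennardJones (dist y (z : E3))| :=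
    Summable.of_nonneg_of_le (fun z => abs_nonneg _) hpt (hs6.mul_left (731 / 12))
  refine ⟨hsum, ?_⟩
  calc ∑' z : Z, |lennardJones (dist y (z : E3))| ≤ ∑' z : Z, 731 / 12 * (dist y (z : E3))⁻¹ ^ 6 :=
        hsum.tsum_le_tsum hpt (hs6.mul_left (731 / 12))
    _ = 731 / 12 * ∑' z : Z, (dist y (z : E3))⁻¹ ^ 6 := tsum_mul_left
    _ ≤ 731 / 12 * (250 * ((1 / 3 : ℝ)⁻¹ ^ 3 * ρ⁻¹ ^ 3)) :=
        mul_le_mul_of_nonneg_left ht6 (by norm_num)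
    _ = ((6750 : ℝ) * (731 / 12)) * ρ⁻¹ ^ 3 := by norm_num; ring

/-- Signed form: `−∑_{z ∈ Z} V_LJ(|y − z|) ≤ ((6750 : ℝ) * (731 / 12)) ρ⁻³` under the same hypotheses. -/
theorem neg_tsum_lennardJones_le {Z : Set E3} (hZ : ∀ z ∈ Z, ∀ w ∈ Z, z ≠ w → 1 / 3 ≤ dist z w)
    {y : E3} {ρ : ℝ} (hρ : 1 / 3 ≤ ρ) (hy : ∀ z ∈ Z, ρ ≤ dist y z) :
    -∑' z : Z, lennardJones (dist y z) ≤ ((6750 : ℝ) * (731 / 12)) * ρ⁻¹ ^ 3 := by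
  obtain ⟨hsum, hle⟩ := tsum_abs_lennardJones_le hZ hρ hy
  rw [← tsum_neg]
  exact (hsum.of_abs.neg.tsum_le_tsum (fun z => neg_le_abs _) hsum).trans hle

/-! ## Enumerated finite parts and the kernel bound on their binding -/

/-- Every finset of `ℝ³` is the range of an injective `Fin`-tuple. -/
theorem exists_enum (F : Finset E3) :
    ∃ xf : Fin F.card → E3, Function.Injective xf ∧ Set.range xf = ↑F := by
  refine ⟨fun i => (F.equivFin.symm i : E3), Subtype.val_injective.comp F.equivFin.symm.injective, ?_⟩
  ext y
  constructor
  · rintro ⟨i, rfl⟩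
    exact (F.equivFin.symm i).2
  · intro hy
    exact ⟨F.equivFin ⟨y, hy⟩, by simp⟩

/-- Reindexing a sum along an injective enumeration of a finset. -/
theorem sum_eq_sum_of_range_eq {n : ℕ} {xf : Fin n → E3} (hxf : Function.Injective xf)
    {F : Finset E3} (hF : Set.range xf = ↑F) (g : E3 → ℝ) : ∑ i, g (xf i) = ∑ y ∈ F, g y := by
  classical
  have himg : Finset.univ.image xf = F := by
    apply Finset.coe_injective
    rw [Finset.coe_image, Finset.coe_univ, Set.image_univ, hF]
  rw [← himg, Finset.sum_image fun i _ j _ h => hxf h]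

/-- **Kernel bound on the binding of a ball.** If `S` is `1/3`-separated and `xf` enumerates
`F = S ∩ B̄_j(x)`, then `−I(F, S ∖ F) ≤ ∑_{y ∈ F} κ_{⌊j − |y − x|⌋}`: an atom at depth `k` sees
`S ∖ F` only at distances `> k` (and `≥ 1/3`). -/
theorem neg_fieldEnergy_le_sum_kernel {S : Set E3}
    (hsep : ∀ z ∈ S, ∀ w ∈ S, z ≠ w → 1 / 3 ≤ dist z w) (x : E3) (j : ℕ) (F : Finset E3)
    (hF : ∀ y, y ∈ F ↔ y ∈ S ∧ dist y x ≤ j) {n : ℕ} {xf : Fin n → E3}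
    (hxf : Function.Injective xf) (hrange : Set.range xf = ↑F) :
    -fieldEnergy lennardJones xf (S \ ↑F) ≤
      ∑ y ∈ F, ((6750 : ℝ) * (731 / 12)) * (max ((⌊(j : ℝ) - dist y x⌋₊ : ℕ) : ℝ) (1 / 3))⁻¹ ^ 3 := by
  rw [← sum_eq_sum_of_range_eq hxf hrange
      (fun y => ((6750 : ℝ) * (731 / 12)) * (max ((⌊(j : ℝ) - dist y x⌋₊ : ℕ) : ℝ) (1 / 3))⁻¹ ^ 3),
    fieldEnergy_eq, ← Finset.sum_neg_distrib]
  refine Finset.sum_le_sum fun i _ => ?_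
  have hmem : xf i ∈ F := Finset.mem_coe.1 (hrange ▸ Set.mem_range_self i)
  obtain ⟨hyS, hyj⟩ := (hF (xf i)).1 hmem
  have hZsep : ∀ z ∈ S \ (↑F : Set E3), ∀ w ∈ S \ (↑F : Set E3), z ≠ w → 1 / 3 ≤ dist z w :=
    fun z hz w hw hzw => hsep z hz.1 w hw.1 hzw
  have hρ : 1 / 3 ≤ max ((⌊(j : ℝ) - dist (xf i) x⌋₊ : ℕ) : ℝ) (1 / 3) := le_max_right _ _
  have hfar : ∀ z ∈ S \ (↑F : Set E3),
      max ((⌊(j : ℝ) - dist (xf i) x⌋₊ : ℕ) : ℝ) (1 / 3) ≤ dist (xf i) z := by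
    intro z hz
    have hzS : z ∈ S := hz.1
    have hzF : z ∉ F := fun h => hz.2 (Finset.mem_coe.2 h)
    have hzj : (j : ℝ) < dist z x := by
      by_contra hle
      exact hzF ((hF z).2 ⟨hzS, not_lt.1 hle⟩)
    have hyz : xf i ≠ z := fun h => hzF (h ▸ hmem)
    refine max_le ?_ (hsep _ hyS z hzS hyz)
    have hk_le : ((⌊(j : ℝ) - dist (xf i) x⌋₊ : ℕ) : ℝ) ≤ (j : ℝ) - dist (xf i) x :=
      Nat.floor_le (by linarith)
    have htri : dist z x ≤ dist z (xf i) + dist (xf i) x := dist_triangle z (xf i) x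
    rw [dist_comm z (xf i)] at htri
    linarith
  exact neg_tsum_lennardJones_le hZsep hρ hfar

/-- **Per-radius inequality.** Under (ST) with constant `σ`, in an `e*`-μGSC with hard core `1/3`:
`σ·#(S ∩ B̄_j(x))^{2/3} ≤ ∑_{y ∈ S ∩ B̄_j(x)} κ_{⌊j − |y−x|⌋}` (removal test of the ball vs (ST)). -/
theorem per_radius {σ : ℝ}
    (hST : ∀ (N : ℕ) (y : Fin N → EuclideanSpace ℝ (Fin 3)), Function.Injective y →
      (N : ℝ) * eStar + σ * (N : ℝ) ^ (2 / 3 : ℝ) ≤ interactionEnergy lennardJones y)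
    {S : Set E3} (hsep : ∀ z ∈ S, ∀ w ∈ S, z ≠ w → 1 / 3 ≤ dist z w)
    (h : IsMuGSC lennardJones eStar S) (x : E3) (j : ℕ) (F : Finset E3)
    (hF : ∀ y, y ∈ F ↔ y ∈ S ∧ dist y x ≤ j) :
    σ * (F.card : ℝ) ^ (2 / 3 : ℝ) ≤
      ∑ y ∈ F, ((6750 : ℝ) * (731 / 12)) * (max ((⌊(j : ℝ) - dist y x⌋₊ : ℕ) : ℝ) (1 / 3))⁻¹ ^ 3 := by
  obtain ⟨xf, hxf, hrange⟩ := exists_enum F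
  have hsub : Set.range xf ⊆ S := by
    rw [hrange]
    exact fun y hy => ((hF y).1 hy).1
  have hrem := h.removal hxf hsub
  rw [hrange] at hrem
  have hst := hST F.card xf hxf
  have hB := neg_fieldEnergy_le_sum_kernel hsep x j F hF hxf hrange
  linarith

/-! ## The discrete isoperimetric induction -/

/-- `∑_{i < j} i² = (j−1)j(2j−1)/6`. -/
theorem sum_range_sq (j : ℕ) :
    ∑ i ∈ Finset.range j, ((i : ℕ) : ℝ) ^ 2 = ((j : ℝ) - 1) * j * (2 * j - 1) / 6 := by
  induction j with
  | zero => simp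
  | succ k ih =>
    rw [Finset.sum_range_succ, ih]
    push_cast
    ring

/-- **Sequence lemma.** If `n : ℕ → ℝ` is monotone, `n 0 ≥ 1`, and `σ ∑_{i ≤ j} n_i^{2/3} ≤ K n_j`
for all `j`, then `n_j ≥ min(1, σ/(12K))³·j³` (strong induction, `∑_{i<j} i² ≥ j³/12` for `j ≥ 2`). -/
theorem cubic_of_summed_isoperimetry {σ K : ℝ} (hσ : 0 < σ) (hK : 0 < K) {n : ℕ → ℝ}
    (h0 : 1 ≤ n 0) (hmono : Monotone n)
    (h : ∀ j : ℕ, σ * ∑ i ∈ Finset.range (j + 1), n i ^ (2 / 3 : ℝ) ≤ K * n j) :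
    ∀ j : ℕ, (min 1 (σ / (12 * K))) ^ 3 * (j : ℝ) ^ 3 ≤ n j := by
  set b := min 1 (σ / (12 * K)) with hb
  have hb0 : 0 < b := lt_min one_pos (by positivity)
  have hb1 : b ≤ 1 := min_le_left _ _
  have hbK : b ≤ σ / (12 * K) := min_le_right _ _
  have hn1 : ∀ j, 1 ≤ n j := fun j => h0.trans (hmono (Nat.zero_le j))
  intro j
  induction j using Nat.strong_induction_on with
  | _ j ih =>
    rcases Nat.lt_or_ge j 2 with hj | hj
    · interval_cases j
      · simp only [Nat.cast_zero]
        have := hn1 0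
        nlinarith
      · simp only [Nat.cast_one, one_pow, mul_one]
        have h3 : b ^ 3 ≤ 1 := pow_le_one₀ hb0.le hb1
        linarith [hn1 1]
    · have key : σ * ∑ i ∈ Finset.range j, n i ^ (2 / 3 : ℝ) ≤ K * n j := by
        refine le_trans (mul_le_mul_of_nonneg_left ?_ hσ.le) (h j)
        exact Finset.sum_le_sum_of_subset_of_nonneg (Finset.range_mono (Nat.le_succ j))
          fun i _ _ => Real.rpow_nonneg (by linarith [hn1 i]) _
      have hlow : ∀ i ∈ Finset.range j, b ^ 2 * ((i : ℕ) : ℝ) ^ 2 ≤ n i ^ (2 / 3 : ℝ) := by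
        intro i hi
        have hi' : b ^ 3 * (i : ℝ) ^ 3 ≤ n i := ih i (Finset.mem_range.1 hi)
        have h1 : ((b * i) ^ 3 : ℝ) ≤ n i := by rw [mul_pow]; exact hi'
        have h2 : (0 : ℝ) ≤ (b * i) ^ 3 := by positivity
        have e1 : ((b * (i : ℝ)) ^ 3) ^ (2 / 3 : ℝ) = (b * (i : ℝ)) ^ 2 := by
          rw [← Real.rpow_natCast (b * (i : ℝ)) 3, ← Real.rpow_mul (by positivity)]
          norm_num
        calc b ^ 2 * ((i : ℕ) : ℝ) ^ 2 = (b * (i : ℝ)) ^ 2 := by ring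
          _ = ((b * (i : ℝ)) ^ 3) ^ (2 / 3 : ℝ) := e1.symm
          _ ≤ n i ^ (2 / 3 : ℝ) := Real.rpow_le_rpow h2 h1 (by norm_num)
      have hS : b ^ 2 * (((j : ℝ) - 1) * j * (2 * j - 1) / 6) ≤
          ∑ i ∈ Finset.range j, n i ^ (2 / 3 : ℝ) := by
        rw [← sum_range_sq, Finset.mul_sum]
        exact Finset.sum_le_sum hlow
      have hj2 : (2 : ℝ) ≤ j := by exact_mod_cast hj
      have hj0 : (0 : ℝ) ≤ j := by positivity
      have h12 : (j : ℝ) ^ 3 / 12 ≤ ((j : ℝ) - 1) * j * (2 * j - 1) / 6 := by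
        nlinarith [mul_nonneg (mul_nonneg hj0 hj0) (sub_nonneg.2 hj2)]
      have hKb : K * b ≤ σ / 12 := by
        have := (le_div_iff₀ (by positivity : (0 : ℝ) < 12 * K)).1 hbK
        linarith
      have hfin : K * (b ^ 3 * (j : ℝ) ^ 3) ≤ K * n j :=
        calc K * (b ^ 3 * (j : ℝ) ^ 3) = (K * b) * (b ^ 2 * (j : ℝ) ^ 3) := by ring
          _ ≤ (σ / 12) * (b ^ 2 * (j : ℝ) ^ 3) := by gcongr
          _ = σ * (b ^ 2 * ((j : ℝ) ^ 3 / 12)) := by ring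
          _ ≤ σ * (b ^ 2 * (((j : ℝ) - 1) * j * (2 * j - 1) / 6)) := by gcongr
          _ ≤ σ * ∑ i ∈ Finset.range j, n i ^ (2 / 3 : ℝ) := by gcongr
          _ ≤ K * n j := key
      exact le_of_mul_le_mul_left hfin hK

/-! ## Assembly: (ST) ⟹ uniform cubic volume growth -/

/-- **Volume growth from surface tension.** (ST) `∃ σ > 0, GapWith (1/100) 0 (-σ)` implies the
statement of stub S4 `stub_dlrVolumeGrowth` verbatim, with `c = min(1, σ/(12((6750 : ℝ) * (731 / 12) * 29)))³/8` (hard core ⇒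
per-radius inequality ⇒ summed and swapped ⇒ sequence lemma ⇒ `n_{⌊R⌋} ≥ c₀⌊R⌋³ ≥ (c₀/8)R³`). -/
theorem dlrVolumeGrowth_of_gapWith (hST : ∃ σ : ℝ, 0 < σ ∧ GapWith (1 / 100) 0 (-σ)) :
    ∃ c : ℝ, 0 < c ∧ ∀ S : Set (EuclideanSpace ℝ (Fin 3)), UniformlyDiscrete S → IsMuGSC lennardJones eStar S →
      ∀ x ∈ S, ∀ R : ℝ, 1 ≤ R → c * R ^ 3 ≤ ({y ∈ S | dist y x ≤ R}.ncard : ℝ) := by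
  classical
  obtain ⟨σ, hσ, hgap⟩ := hST
  have hST := surface_of_gapWith hgap
  have hK : (0 : ℝ) < ((6750 : ℝ) * (731 / 12) * 29) := by norm_num
  set b : ℝ := min 1 (σ / (12 * ((6750 : ℝ) * (731 / 12) * 29))) with hb
  have hb0 : 0 < b := lt_min one_pos (div_pos hσ (by norm_num))
  refine ⟨b ^ 3 / 8, by positivity, fun S hS h x hx R hR => ?_⟩
  have hsep := le_dist hS h
  have hfin : ∀ r : ℝ, {y ∈ S | dist y x ≤ r}.Finite := fun r => hS.finite_inter_closedBall x r
  set F : ℕ → Finset E3 := fun j => (hfin j).toFinset with hFdef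
  have hF : ∀ (j : ℕ) (y : E3), y ∈ F j ↔ y ∈ S ∧ dist y x ≤ j := fun j y => by
    simp only [hFdef, Set.Finite.mem_toFinset, Set.mem_setOf_eq]
  set n : ℕ → ℝ := fun j => ((F j).card : ℝ) with hndef
  have hmono : Monotone n := by
    intro i j hij
    have hsub : F i ⊆ F j := fun y hy =>
      (hF j y).2 ⟨((hF i y).1 hy).1, ((hF i y).1 hy).2.trans (by exact_mod_cast hij)⟩
    simp only [hndef]
    exact_mod_cast Finset.card_le_card hsub
  have h0 : 1 ≤ n 0 := by
    have hx0 : x ∈ F 0 := (hF 0 x).2 ⟨hx, by simp⟩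
    simp only [hndef]
    exact Nat.one_le_cast.2 (Finset.card_pos.2 ⟨x, hx0⟩)
  have hsum : ∀ j : ℕ, σ * ∑ i ∈ Finset.range (j + 1), n i ^ (2 / 3 : ℝ) ≤ ((6750 : ℝ) * (731 / 12) * 29) * n j := by
    intro j
    calc σ * ∑ i ∈ Finset.range (j + 1), n i ^ (2 / 3 : ℝ)
        = ∑ i ∈ Finset.range (j + 1), σ * n i ^ (2 / 3 : ℝ) := Finset.mul_sum _ _ _
      _ ≤ ∑ i ∈ Finset.range (j + 1), ∑ y ∈ F i,
            ((6750 : ℝ) * (731 / 12)) * (max ((⌊(i : ℝ) - dist y x⌋₊ : ℕ) : ℝ) (1 / 3))⁻¹ ^ 3 :=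
          Finset.sum_le_sum fun i _ => per_radius hST hsep h x i (F i) (hF i)
      _ = ∑ i ∈ Finset.range (j + 1), ∑ y ∈ F j, (if dist y x ≤ (i : ℝ) then
            ((6750 : ℝ) * (731 / 12)) * (max ((⌊(i : ℝ) - dist y x⌋₊ : ℕ) : ℝ) (1 / 3))⁻¹ ^ 3 else 0) := by
          refine Finset.sum_congr rfl fun i hi => ?_
          have hij : i ≤ j := Nat.lt_succ_iff.1 (Finset.mem_range.1 hi)
          have hFi : F i = (F j).filter (fun y => dist y x ≤ (i : ℝ)) := by
            ext y
            simp only [Finset.mem_filter, hF]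
            exact ⟨fun ⟨hyS, hyi⟩ => ⟨⟨hyS, hyi.trans (by exact_mod_cast hij)⟩, hyi⟩,
              fun ⟨⟨hyS, _⟩, hyi⟩ => ⟨hyS, hyi⟩⟩
          rw [hFi, Finset.sum_filter]
      _ = ∑ y ∈ F j, ∑ i ∈ Finset.range (j + 1), (if dist y x ≤ (i : ℝ) then
            ((6750 : ℝ) * (731 / 12)) * (max ((⌊(i : ℝ) - dist y x⌋₊ : ℕ) : ℝ) (1 / 3))⁻¹ ^ 3 else 0) :=
          Finset.sum_comm
      _ ≤ ∑ y ∈ F j, ((6750 : ℝ) * (731 / 12) * 29) := by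
          refine Finset.sum_le_sum fun y _ => ?_
          rw [← Finset.sum_filter]
          exact sum_kernel_floor_le (dist y x) j
      _ = ((6750 : ℝ) * (731 / 12) * 29) * n j := by simp only [Finset.sum_const, nsmul_eq_mul, hndef, mul_comm]
  have hcubic := cubic_of_summed_isoperimetry hσ hK h0 hmono hsum
  -- from integer radii to `R`
  set m := ⌊R⌋₊ with hm
  have hm1 : 1 ≤ m := (Nat.one_le_floor_iff R).2 hR
  have hmR : R / 2 ≤ (m : ℝ) := by
    have h1 : R < (m : ℝ) + 1 := Nat.lt_floor_add_one R
    by_cases hR2 : R ≤ 2 <;> linarith [(by exact_mod_cast hm1 : (1 : ℝ) ≤ m)]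
  have hcount : n m ≤ ({y ∈ S | dist y x ≤ R}.ncard : ℝ) := by
    simp only [hndef]
    rw [← Set.ncard_coe_finset (F m)]
    have hsub : (↑(F m) : Set E3) ⊆ {y ∈ S | dist y x ≤ R} := fun y hy => by
      obtain ⟨hyS, hyd⟩ := (hF m y).1 (Finset.mem_coe.1 hy)
      exact ⟨hyS, hyd.trans (Nat.floor_le (by linarith))⟩
    exact_mod_cast Set.ncard_le_ncard hsub (hfin R)
  calc b ^ 3 / 8 * R ^ 3 = b ^ 3 * (R / 2) ^ 3 := by ring
    _ ≤ b ^ 3 * (m : ℝ) ^ 3 := by gcongr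
    _ ≤ n m := hcubic m
    _ ≤ _ := hcount

/-- **Registered marker `stub_dlrBadZeroDensity_part02`** (groundwork for the open stub S3′ of line
`equilibrium-in-law-surgery`, crux `MinimiserShells`): particle-level positive surface tension
`∃ σ > 0, GapWith (1/100) 0 (−σ)` (i.e. `𝓔_N ≥ N e* + σ N^{2/3}`, OPEN) implies cubic volume growth of every
uniformly discrete e*-μGSC with a uniform constant (gen-2 stub S4 verbatim) — `dlrVolumeGrowth_of_gapWith`. -/
theorem stub_dlrBadZeroDensity_part02 :
    (∃ σ : ℝ, 0 < σ ∧ Summit.AtomisticToContinuum.Crystallization.Theorems.ChargedEnergyGapNegative.GapWith (1 / 100) 0 (-σ)) →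
      ∃ c : ℝ, 0 < c ∧ ∀ S : Set (EuclideanSpace ℝ (Fin 3)), UniformlyDiscrete S → IsMuGSC lennardJones eStar S →
        ∀ x ∈ S, ∀ R : ℝ, 1 ≤ R → c * R ^ 3 ≤ ({y ∈ S | dist y x ≤ R}.ncard : ℝ) :=
  dlrVolumeGrowth_of_gapWith

end Summit.AtomisticToContinuum.Crystallization.Theorems.PalmUnimodularRigidityMinimiserShells.VolumeGrowth

end
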